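import Mathlib
import HarnessLib
import Summits.FinalStateConjecture.FinalStateConjecture.Statement
import Literature.Geometry.Lorentzian.TimelikeCurveLiftLocal
import Literature.Geometry.Lorentzian.HypersurfaceRestriction
import Literature.Geometry.Lorentzian.ConvergenceTransport

/-!
# Crux `RecurrentlyFlatDisperses` (stmt-FinalStateConjecture-14665), line `Sketch`
# (card `outgoing-blind-cup-restart`) — stub `stub_futureSet`, part 1: the cone of an anchored chart
# and the coordinate lift of timelike curves

Support file (1 of 3) for the registered stub `stub_futureSet` (FUTURE SET: the late image
`W = Ψ₀{x⁰ > τ₀}` of an anchored flat late chart is a future set), proved in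
`…Theorems.ClusterCompletenessRecurrentlyFlatDispersesStubFutureSet` by a first-exit argument along
future timelike curves. This part contains the pointwise linear algebra and the lift:

* CONE ESTIMATE (`cone_of_deviation`): if `‖Ψ^* g − η‖ ≤ 1/4` at `y` (operator norm on `E4`) and
  `dΨ ∂₀` is future-directed, every `w ∈ E4` with `dΨ w` future-directed timelike has `w⁰ > 0` and
  `‖w‖ < 2 w⁰`: `g(dΨ w, dΨ w) = ‖w‖² − 2(w⁰)² + dev(w, w) < 0` and
  `g(dΨ ∂₀, dΨ w) = −w⁰ + dev(∂₀, w) < 0` (two future-directed vectors, one timelike: O'Neill 1983,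
  Ch. 5, Lemma 5.29, `TimeOrientation.IsFutureDirected.val_lt_zero`), with `|dev(u, v)| ≤ ‖u‖‖v‖/4`;
  the same algebra shows `dΨ_y` injective (`mfderiv_injective_of_deviation`).
* LIFT (`lift_cone`): for an injective smooth local diffeomorphism `Φ : V → 𝓢`, `V ⊆ E4` open, a
  future timelike curve inside `Φ(V)` has a differentiable coordinate lift `Φ⁻¹ ∘ γ`
  (`mdifferentiableAt_invFun_comp_and_mfderiv`, O'Neill 1983, Ch. 3, pp. 90–91) whose derivative
  obeys the cone estimate; hence (`strictMonoOn_apply_zero`, `norm_sub_le_of_hasDerivAt`) its chart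
  time increases strictly and `‖c(s₂) − c(s₁)‖ ≤ 2 (c⁰(s₂) − c⁰(s₁))` (mean value inequality).
* Bookkeeping for the inclusion of open subsets of `E4` (`mfderiv_comp_inclusion`, `dι = id`).

Mathlib + the Literature cone only; no definitions, no named facts.
-/

noncomputable section

open scoped Manifold ContDiff Topology
open Bundle Filter Set Function TopologicalSpace Literature.Geometry.Lorentzian

namespace Summit.FinalStateConjecture.FinalStateConjecture.Theorems.RecurrentlyFlatDisperses

namespace FutureSet

/-! ### Cone arithmetic for bilinear forms within `1/4` of `η` on `E4` -/

/-- `η(w, w) = ‖w‖² - 2 (w⁰)²` for the Minkowski form on `E4` (Euclidean norm). -/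
private theorem minkowski_self_eq (w : E4) :
    Minkowski.bilin w w = ‖w‖ ^ 2 - 2 * w 0 ^ 2 := by
  have h1 : ‖w‖ ^ 2 = w 0 ^ 2 + ∑ i : Fin 3, w i.succ ^ 2 := by
    rw [EuclideanSpace.real_norm_sq_eq]
    exact Fin.sum_univ_succ (fun i : Fin 4 ↦ w i ^ 2)
  have h2 : ∑ i : Fin 3, w i.succ * w i.succ = ∑ i : Fin 3, w i.succ ^ 2 :=
    Finset.sum_congr rfl fun i _ ↦ (sq _).symm
  rw [Minkowski.bilin_apply, h2, h1]
  ring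

/-- Real-arithmetic core of the cone estimate: with `N = ‖w‖`, `t = w⁰`, `|a| ≤ N²/4`,
`|b| ≤ N/4`, the inequalities `N² - 2t² + a < 0` (`G(w,w) < 0`) and `-t + b < 0`
(`G(∂₀, w) < 0`) force `t > 0` and `N < 2t`. -/
private theorem cone_arith {N t a b : ℝ} (hN : 0 ≤ N) (ha : |a| ≤ 1 / 4 * N ^ 2)
    (hb : |b| ≤ 1 / 4 * N) (h1 : N ^ 2 - 2 * t ^ 2 + a < 0) (h2 : -t + b < 0) :
    0 < t ∧ N < 2 * t := by
  have h3 : 3 / 4 * N ^ 2 < 2 * t ^ 2 := by linarith [(abs_le.1 ha).1]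
  have h5 : -(1 / 4 * N) < t := by linarith [(abs_le.1 hb).1]
  have ht : 0 < t := by
    by_contra ht
    push Not at ht
    have h6 : t ^ 2 < (1 / 4 * N) ^ 2 := sq_lt_sq' h5 (by linarith)
    nlinarith [sq_nonneg N]
  refine ⟨ht, ?_⟩
  by_contra h
  push Not at h
  nlinarith [mul_le_mul h h (by linarith) hN]

/-- Real-arithmetic core of the kernel estimate: `N² - 2t² + a = 0` and `-t + b = 0` with
`|a| ≤ N²/4`, `|b| ≤ N/4` force `N = 0`. -/
private theorem kernel_arith {N t a b : ℝ} (hN : 0 ≤ N) (ha : |a| ≤ 1 / 4 * N ^ 2)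
    (hb : |b| ≤ 1 / 4 * N) (h1 : N ^ 2 - 2 * t ^ 2 + a = 0) (h2 : -t + b = 0) : N = 0 := by
  have htb : t = b := by linarith
  have h3 : |t| ≤ 1 / 4 * N := htb ▸ hb
  have h4 : t ^ 2 ≤ (1 / 4 * N) ^ 2 := by
    rw [← sq_abs t]
    exact pow_le_pow_left₀ (abs_nonneg t) h3 2
  have h5 : N ^ 2 ≤ 0 := by nlinarith [(abs_le.1 ha).1, h4]
  by_contra hne
  have : 0 < N := lt_of_le_of_ne hN (Ne.symm hne)
  nlinarith

/-! ### The anchored chart: cone and kernel estimates for `dΨ` -/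

/-- **Pointwise consequence of the `C⁰` anchor**: if `‖Ψ^* g − η‖ ≤ 1/4` at `y` (operator norm on
`E4`), then `g(dΨ ∂₀, dΨ ∂₀) ≤ -1 + 1/4 = -3/4` (copied from the landed neighbour
`stub_chartFuture`). -/
theorem val_mfderiv_basisVector_zero_le {𝓢 : Spacetime 4} {U₀ : Opens E4}
    (Ψ : U₀ → 𝓢.carrier) (y : U₀)
    (h : ‖𝓢.deviation (Minkowski.backgroundOn U₀) Ψ y‖ ≤ 1 / 4) :
    𝓢.metric.val (Ψ y) (mfderiv 𝓘(ℝ, E4) (𝓡 4) Ψ y (E4.basisVector 0))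
      (mfderiv 𝓘(ℝ, E4) (𝓡 4) Ψ y (E4.basisVector 0)) ≤ -(3 / 4) := by
  have h1 := 𝓢.deviation_apply (Minkowski.backgroundOn U₀) Ψ y (E4.basisVector 0)
    (E4.basisVector 0)
  have h2 : (Minkowski.backgroundOn U₀).bilin y.1 (E4.basisVector 0) (E4.basisVector 0) = -1 :=
    Minkowski.bilin_basisVector_zero
  have hn : ‖(E4.basisVector 0 : E4)‖ = 1 := by simp [E4.basisVector]
  have h3 : ‖𝓢.deviation (Minkowski.backgroundOn U₀) Ψ y (E4.basisVector 0) (E4.basisVector 0)‖ ≤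
      1 / 4 := by
    refine (ContinuousLinearMap.le_opNorm₂ _ _ _).trans ?_
    rw [hn, mul_one, mul_one]
    exact h
  rw [Real.norm_eq_abs] at h3
  have h4 := (le_abs_self _).trans h3
  rw [h1, h2] at h4
  exact (sub_le_iff_le_add.mp h4).trans (by norm_num)

/-- The pulled-back metric in terms of the deviation: `g(dΨ u, dΨ v) = η(u, v) + (Ψ^*g - η)(u, v)`,
and the operator-norm bounds `|(Ψ^*g - η)(w, w)| ≤ ‖w‖²/4`, `|(Ψ^*g - η)(∂₀, w)| ≤ ‖w‖/4` under the
anchor. -/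
private theorem val_mfderiv_eq_add_deviation {𝓢 : Spacetime 4} {U₀ : Opens E4}
    (Ψ : U₀ → 𝓢.carrier) (y : U₀)
    (h : ‖𝓢.deviation (Minkowski.backgroundOn U₀) Ψ y‖ ≤ 1 / 4) (w : E4) :
    𝓢.metric.val (Ψ y) (mfderiv 𝓘(ℝ, E4) (𝓡 4) Ψ y w) (mfderiv 𝓘(ℝ, E4) (𝓡 4) Ψ y w) =
        ‖w‖ ^ 2 - 2 * w 0 ^ 2 + 𝓢.deviation (Minkowski.backgroundOn U₀) Ψ y w w ∧
      𝓢.metric.val (Ψ y) (mfderiv 𝓘(ℝ, E4) (𝓡 4) Ψ y (E4.basisVector 0))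
          (mfderiv 𝓘(ℝ, E4) (𝓡 4) Ψ y w) =
        -w 0 + 𝓢.deviation (Minkowski.backgroundOn U₀) Ψ y (E4.basisVector 0) w ∧
      |𝓢.deviation (Minkowski.backgroundOn U₀) Ψ y w w| ≤ 1 / 4 * ‖w‖ ^ 2 ∧
      |𝓢.deviation (Minkowski.backgroundOn U₀) Ψ y (E4.basisVector 0) w| ≤ 1 / 4 * ‖w‖ := by
  have hn : ‖(E4.basisVector 0 : E4)‖ = 1 := by simp [E4.basisVector]
  -- the unfolding lemma, elaborated against the present statement of the terms
  have k1 : 𝓢.deviation (Minkowski.backgroundOn U₀) Ψ y w w =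
      𝓢.metric.val (Ψ y) (mfderiv 𝓘(ℝ, E4) (𝓡 4) Ψ y w) (mfderiv 𝓘(ℝ, E4) (𝓡 4) Ψ y w) -
        Minkowski.bilin w w :=
    𝓢.deviation_apply (Minkowski.backgroundOn U₀) Ψ y w w
  have k2 : 𝓢.deviation (Minkowski.backgroundOn U₀) Ψ y (E4.basisVector 0) w =
      𝓢.metric.val (Ψ y) (mfderiv 𝓘(ℝ, E4) (𝓡 4) Ψ y (E4.basisVector 0))
          (mfderiv 𝓘(ℝ, E4) (𝓡 4) Ψ y w) - Minkowski.bilin (E4.basisVector 0) w :=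
    𝓢.deviation_apply (Minkowski.backgroundOn U₀) Ψ y (E4.basisVector 0) w
  rw [minkowski_self_eq] at k1
  rw [Minkowski.bilin_basisVector_zero_left] at k2
  refine ⟨by linarith, by linarith, ?_, ?_⟩
  · rw [← Real.norm_eq_abs]
    refine (ContinuousLinearMap.le_opNorm₂ _ _ _).trans ?_
    have : ‖𝓢.deviation (Minkowski.backgroundOn U₀) Ψ y‖ * ‖w‖ * ‖w‖ ≤ 1 / 4 * ‖w‖ * ‖w‖ :=
      mul_le_mul_of_nonneg_right (mul_le_mul_of_nonneg_right h (norm_nonneg _)) (norm_nonneg _)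
    nlinarith [this]
  · rw [← Real.norm_eq_abs]
    refine (ContinuousLinearMap.le_opNorm₂ _ _ _).trans ?_
    rw [hn, mul_one]
    exact mul_le_mul_of_nonneg_right h (norm_nonneg _)

/-- **Cone estimate of the anchored chart.** If `‖Ψ^*g - η‖ ≤ 1/4` at `y` and `dΨ ∂₀` is
future-directed there, then every `w ∈ E4` whose push-forward `dΨ w` is future-directed timelike has
positive time component and `‖w‖ < 2 w⁰` (so the chart time increases along future timelike curves,
with spatial speed at most twice the time speed): `g(dΨ w, dΨ w) < 0` gives
`(3/4)‖w‖² < 2(w⁰)²`, and `g(dΨ ∂₀, dΨ w) < 0` (two future-directed vectors, one timelike: O'Neill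
1983, Ch. 5, Lemma 5.29) gives `w⁰ > -‖w‖/4`. -/
theorem cone_of_deviation {𝓢 : Spacetime 4} {U₀ : Opens E4} (Ψ : U₀ → 𝓢.carrier)
    (y : U₀) (h : ‖𝓢.deviation (Minkowski.backgroundOn U₀) Ψ y‖ ≤ 1 / 4)
    (hfut : 𝓢.timeOrientation.IsFutureDirected
      (mfderiv 𝓘(ℝ, E4) (𝓡 4) Ψ y (E4.basisVector 0)))
    (w : E4) (htl : 𝓢.metric.IsTimelike (mfderiv 𝓘(ℝ, E4) (𝓡 4) Ψ y w))
    (hwf : 𝓢.timeOrientation.IsFutureDirected (mfderiv 𝓘(ℝ, E4) (𝓡 4) Ψ y w)) :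
    0 < w 0 ∧ ‖w‖ < 2 * w 0 := by
  obtain ⟨e1, e2, b1, b2⟩ := val_mfderiv_eq_add_deviation Ψ y h w
  have hv0t : 𝓢.metric.IsTimelike (mfderiv 𝓘(ℝ, E4) (𝓡 4) Ψ y (E4.basisVector 0)) :=
    lt_of_le_of_lt (val_mfderiv_basisVector_zero_le Ψ y h) (by norm_num)
  have hlt := hfut.val_lt_zero 𝓢.timeOrientation hv0t hwf
  rw [e2] at hlt
  have htl' : 𝓢.metric.val (Ψ y) (mfderiv 𝓘(ℝ, E4) (𝓡 4) Ψ y w)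
      (mfderiv 𝓘(ℝ, E4) (𝓡 4) Ψ y w) < 0 := htl
  rw [e1] at htl'
  exact cone_arith (norm_nonneg w) b1 b2 htl' hlt

/-- **The anchored chart is an immersion**: if `‖Ψ^*g - η‖ ≤ 1/4` at `y` then `dΨ_y` is injective
(`dΨ w = 0` makes `g(dΨ w, dΨ w) = g(dΨ ∂₀, dΨ w) = 0`, i.e. `(3/4)‖w‖² ≤ 2 (w⁰)² ≤ ‖w‖²/8`). -/
theorem mfderiv_injective_of_deviation {𝓢 : Spacetime 4} {U₀ : Opens E4}
    (Ψ : U₀ → 𝓢.carrier) (y : U₀) (h : ‖𝓢.deviation (Minkowski.backgroundOn U₀) Ψ y‖ ≤ 1 / 4) :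
    Injective (mfderiv 𝓘(ℝ, E4) (𝓡 4) Ψ y) := by
  refine (injective_iff_map_eq_zero _).2 fun w hw ↦ ?_
  obtain ⟨e1, e2, b1, b2⟩ := val_mfderiv_eq_add_deviation Ψ y h w
  rw [hw, map_zero] at e1
  rw [hw, map_zero] at e2
  have hN := kernel_arith (@norm_nonneg E4 _ w) b1 b2 e1.symm e2.symm
  have hw0 : @Eq E4 w 0 := (@norm_eq_zero E4 _ w).1 hN
  exact hw0

/-! ### Open subsets of `E4`: inclusions and ranges -/

/-- **The differential of `Ψ ∘ ι` for the inclusion `ι : V ↪ U` of open subsets of `E4` is the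
differential of `Ψ`** (`dι = id`, Lee 2013, Prop. 3.9). -/
theorem mfderiv_comp_inclusion {M : Type*} [TopologicalSpace M]
    [ChartedSpace (EuclideanSpace ℝ (Fin 4)) M] {U V : Opens E4} (hVU : V ≤ U) {Ψ : U → M}
    (x : V) (hΨ : MDifferentiableAt 𝓘(ℝ, E4) (𝓡 4) Ψ (Opens.inclusion hVU x)) :
    mfderiv 𝓘(ℝ, E4) (𝓡 4) (Ψ ∘ Opens.inclusion hVU) x =
      mfderiv 𝓘(ℝ, E4) (𝓡 4) Ψ (Opens.inclusion hVU x) := by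
  have hι : ContMDiff 𝓘(ℝ, E4) 𝓘(ℝ, E4) ∞ (Opens.inclusion hVU) := contMDiff_inclusion hVU
  have hιd : MDifferentiableAt 𝓘(ℝ, E4) 𝓘(ℝ, E4) (Opens.inclusion hVU) x :=
    hι.mdifferentiableAt (by simp)
  have hdι : mfderiv 𝓘(ℝ, E4) 𝓘(ℝ, E4) (Opens.inclusion hVU) x = ContinuousLinearMap.id ℝ E4 := by
    have h1 : HasMFDerivAt 𝓘(ℝ, E4) 𝓘(ℝ, E4) (Subtype.val ∘ Opens.inclusion hVU : V → E4) x
        ((ContinuousLinearMap.id ℝ E4).comp (mfderiv 𝓘(ℝ, E4) 𝓘(ℝ, E4) (Opens.inclusion hVU) x)) :=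
      (hasMFDerivAt_subtypeVal (Opens.inclusion hVU x)).comp x hιd.hasMFDerivAt
    have h2 : HasMFDerivAt 𝓘(ℝ, E4) 𝓘(ℝ, E4) (Subtype.val : V → E4) x
        (ContinuousLinearMap.id ℝ E4) := hasMFDerivAt_subtypeVal x
    have h3 : (Subtype.val ∘ Opens.inclusion hVU : V → E4) = Subtype.val := rfl
    rw [h3] at h1
    have h4 := hasMFDerivAt_unique h1 h2
    ext v
    have := congrArg (fun f : E4 →L[ℝ] E4 ↦ f v) h4
    exact this
  rw [mfderiv_comp x hΨ hιd, hdι]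
  ext v
  rfl

/-- The range of `Ψ ∘ ι` for the inclusion `ι` of the late half-space `V = {x⁰ > τ₀}` into `U` is
the image of the late region of the Minkowski background on `U`. -/
theorem range_comp_inclusion {α : Type*} {U V : Opens E4} (hVU : V ≤ U) (Ψ : U → α)
    {τ₀ : ℝ} (hV : ∀ p : E4, p ∈ V ↔ τ₀ < p 0) :
    range (Ψ ∘ Opens.inclusion hVU) = Ψ '' (Minkowski.backgroundOn U).lateRegion τ₀ := by
  ext q
  constructor
  · rintro ⟨x, rfl⟩
    exact ⟨Opens.inclusion hVU x, (hV x.1).1 x.2, rfl⟩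
  · rintro ⟨y, hy, rfl⟩
    exact ⟨⟨y.1, (hV y.1).2 hy⟩, congrArg Ψ (Subtype.ext rfl)⟩

/-! ### Lifting curves to the chart -/

/-- Transport of the causal character along an equality of base points (the tangent spaces are all
`E4` definitionally). -/
private theorem isTimelike_transport {𝓢 : Spacetime 4} {p q : 𝓢.carrier} (h : p = q)
    {u : TangentSpace (𝓡 4) p} {u' : TangentSpace (𝓡 4) q} (huu : (u : E4) = u')
    (ht : 𝓢.metric.IsTimelike u') (hf : 𝓢.timeOrientation.IsFutureDirected u') :
    𝓢.metric.IsTimelike u ∧ 𝓢.timeOrientation.IsFutureDirected u := by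
  subst h
  have : u = u' := huu
  subst this
  exact ⟨ht, hf⟩

/-- **The lifted curve in coordinates.** For `Φ : V → 𝓢` (`V ⊆ E4` open) an injective `C^∞` local
diffeomorphism and `γ` differentiable at `t` with `γ t ∈ Φ(V)`, the coordinate lift
`c = Φ⁻¹ ∘ γ : ℝ → E4` has a derivative `w` at `t` with `Φ(Φ⁻¹ γ t) = γ t` and `dΦ(w) = γ'(t)`
(O'Neill 1983, Ch. 3, pp. 90–91; `mdifferentiableAt_invFun_comp_and_mfderiv`). -/
private theorem lift_hasDerivAt {𝓢 : Spacetime 4} {V : Opens E4} [Nonempty V]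
    {Φ : V → 𝓢.carrier} (hΦs : ContMDiff 𝓘(ℝ, E4) (𝓡 4) ∞ Φ) (hinj : Injective Φ)
    (hloc : IsLocalDiffeomorph 𝓘(ℝ, E4) (𝓡 4) ∞ Φ) {γ : ℝ → 𝓢.carrier} {t : ℝ}
    (hγd : MDifferentiableAt 𝓘(ℝ, ℝ) (𝓡 4) γ t) (ht : γ t ∈ range Φ) :
    HasDerivAt (Subtype.val ∘ Function.invFun Φ ∘ γ)
        (velocity 𝓘(ℝ, E4) (Function.invFun Φ ∘ γ) t : E4) t ∧
      Φ ((Function.invFun Φ ∘ γ) t) = γ t ∧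
      mfderiv 𝓘(ℝ, E4) (𝓡 4) Φ ((Function.invFun Φ ∘ γ) t)
        (velocity 𝓘(ℝ, E4) (Function.invFun Φ ∘ γ) t) = velocity (𝓡 4) γ t := by
  obtain ⟨hzd, hΦz, hv⟩ := mdifferentiableAt_invFun_comp_and_mfderiv hΦs hinj hloc hγd ht
  refine ⟨?_, hΦz, hv⟩
  set z : ℝ → V := Function.invFun Φ ∘ γ with hz
  have h1 : HasMFDerivAt 𝓘(ℝ, ℝ) 𝓘(ℝ, E4) (Subtype.val ∘ z) t
      ((ContinuousLinearMap.id ℝ E4).comp (mfderiv 𝓘(ℝ, ℝ) 𝓘(ℝ, E4) z t)) :=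
    (hasMFDerivAt_subtypeVal (z t)).comp t hzd.hasMFDerivAt
  have h2 : mfderiv 𝓘(ℝ, ℝ) 𝓘(ℝ, E4) (Subtype.val ∘ z) t = mfderiv 𝓘(ℝ, ℝ) 𝓘(ℝ, E4) z t := by
    rw [h1.mfderiv, ContinuousLinearMap.id_comp]
  have h3 : DifferentiableAt ℝ (Subtype.val ∘ z) t :=
    mdifferentiableAt_iff_differentiableAt.mp h1.mdifferentiableAt
  have h4 : HasDerivAt (Subtype.val ∘ z) (deriv (Subtype.val ∘ z) t) t := h3.hasDerivAt
  have h5 : deriv (Subtype.val ∘ z) t = (velocity 𝓘(ℝ, E4) z t : E4) := by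
    show fderiv ℝ (Subtype.val ∘ z) t 1 = mfderiv 𝓘(ℝ, ℝ) 𝓘(ℝ, E4) z t 1
    rw [← mfderiv_eq_fderiv, h2]
    rfl
  rw [h5] at h4
  exact h4

/-- **Cone estimate along the lift** (registered sub-goal `lift_cone` of stub `stub_futureSet`):
for `Φ : V → 𝓢` (`V ⊆ E4` open) an injective `C^∞` local diffeomorphism whose differential satisfies
the cone estimate, at a parameter where `γ` is future timelike inside `Φ(V)` the coordinate lift
`Φ⁻¹ ∘ γ` is differentiable with derivative `w`, `w⁰ > 0` and `‖w‖ < 2 w⁰`. -/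
theorem lift_cone : ∀ {𝓢 : Spacetime 4} {V : Opens E4} [Nonempty V] {Φ : V → 𝓢.carrier},
    ContMDiff 𝓘(ℝ, E4) (𝓡 4) ∞ Φ → Function.Injective Φ →
    IsLocalDiffeomorph 𝓘(ℝ, E4) (𝓡 4) ∞ Φ →
    (∀ (x : V) (w : E4), 𝓢.metric.IsTimelike (mfderiv 𝓘(ℝ, E4) (𝓡 4) Φ x w) →
      𝓢.timeOrientation.IsFutureDirected (mfderiv 𝓘(ℝ, E4) (𝓡 4) Φ x w) →
      0 < w 0 ∧ ‖w‖ < 2 * w 0) →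
    ∀ {γ : ℝ → 𝓢.carrier} {t : ℝ},
    (MDifferentiableAt 𝓘(ℝ, ℝ) (𝓡 4) γ t ∧ 𝓢.metric.IsTimelike (velocity (𝓡 4) γ t) ∧
      𝓢.timeOrientation.IsFutureDirected (velocity (𝓡 4) γ t)) →
    γ t ∈ Set.range Φ →
    DifferentiableAt ℝ (Subtype.val ∘ Function.invFun Φ ∘ γ) t ∧
      0 < deriv (Subtype.val ∘ Function.invFun Φ ∘ γ) t 0 ∧
      ‖deriv (Subtype.val ∘ Function.invFun Φ ∘ γ) t‖ <
        2 * deriv (Subtype.val ∘ Function.invFun Φ ∘ γ) t 0 := by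
  intro 𝓢 V _ Φ hΦs hinj hloc hcone γ t hγ ht
  obtain ⟨hd, hΦz, hv⟩ := lift_hasDerivAt hΦs hinj hloc hγ.1 ht
  obtain ⟨htl, hfd⟩ := isTimelike_transport hΦz hv hγ.2.1 hγ.2.2
  refine ⟨hd.differentiableAt, ?_⟩
  rw [hd.deriv]
  exact hcone _ _ htl hfd

/-! ### Real analysis of the coordinate lift -/

/-- The time coordinate of a curve `c : ℝ → E4` with derivative `w` has derivative `w⁰`. -/
private theorem hasDerivAt_apply_zero {c : ℝ → E4} {w : E4} {t : ℝ} (h : HasDerivAt c w t) :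
    HasDerivAt (fun s ↦ c s 0) (w 0) t :=
  ((PiLp.proj 2 (fun _ : Fin 4 ↦ ℝ) (0 : Fin 4)).hasFDerivAt.comp_hasDerivAt t h)

/-- A curve in `E4` whose time coordinate has positive derivative on a convex set has strictly
increasing time coordinate there. -/
theorem strictMonoOn_apply_zero {c w : ℝ → E4} {J : Set ℝ} (hJ : Convex ℝ J)
    (hder : ∀ t ∈ J, HasDerivAt c (w t) t ∧ 0 < w t 0) : StrictMonoOn (fun t ↦ c t 0) J := by
  have hd : ∀ t ∈ J, HasDerivAt (fun s ↦ c s 0) (w t 0) t := fun t ht ↦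
    hasDerivAt_apply_zero (hder t ht).1
  refine strictMonoOn_of_deriv_pos hJ (fun t ht ↦ (hd t ht).continuousAt.continuousWithinAt)
    fun t ht ↦ ?_
  rw [(hd t (interior_subset ht)).deriv]
  exact (hder t (interior_subset ht)).2

/-- **Displacement bound**: if `‖c'‖ ≤ 2 (c⁰)'` on `[s₁, s₂]` then
`‖c s₂ - c s₁‖ ≤ 2 (c⁰ s₂ - c⁰ s₁)` (Mathlib's
`image_norm_le_of_norm_deriv_right_le_deriv_boundary'`). -/
theorem norm_sub_le_of_hasDerivAt {c w : ℝ → E4} {s₁ s₂ : ℝ} (hs : s₁ ≤ s₂)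
    (hder : ∀ t ∈ Icc s₁ s₂, HasDerivAt c (w t) t ∧ ‖w t‖ ≤ 2 * w t 0) :
    ‖c s₂ - c s₁‖ ≤ 2 * (c s₂ 0 - c s₁ 0) := by
  have hd : ∀ t ∈ Icc s₁ s₂, HasDerivAt (fun s ↦ c s - c s₁) (w t) t := fun t ht ↦
    (hder t ht).1.sub_const _
  have hB : ∀ t ∈ Icc s₁ s₂, HasDerivAt (fun s ↦ 2 * (c s 0 - c s₁ 0)) (2 * w t 0) t :=
    fun t ht ↦ ((hasDerivAt_apply_zero (hder t ht).1).sub_const _).const_mul 2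
  have key := image_norm_le_of_norm_deriv_right_le_deriv_boundary' (f := fun s ↦ c s - c s₁)
    (f' := w) (a := s₁) (b := s₂) (B := fun s ↦ 2 * (c s 0 - c s₁ 0)) (B' := fun t ↦ 2 * w t 0)
    (fun t ht ↦ (hd t ht).continuousAt.continuousWithinAt)
    (fun t ht ↦ (hd t (Ico_subset_Icc_self ht)).hasDerivWithinAt) (by simp)
    (fun t ht ↦ (hB t ht).continuousAt.continuousWithinAt)
    (fun t ht ↦ (hB t (Ico_subset_Icc_self ht)).hasDerivWithinAt)
    (fun t ht ↦ (hder t (Ico_subset_Icc_self ht)).2)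
  exact key ⟨hs, le_rfl⟩


end FutureSet

end Summit.FinalStateConjecture.FinalStateConjecture.Theorems.RecurrentlyFlatDisperses

end
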